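import Summits.HodgeConjecture.HodgeConjecture.Cruxes.BlochSeedDiscOne.SeedCheckerSplitBlockPicZeroPin

/-!
line stmt-HodgeConjecture-18881 Cruxes/BlochSeedDiscOne/Lines/birth.lean 814a6a70c14e831a stub_rung_pad4_seedAt

# SeedCheckerSplitBlockDecSepWiring — v42.5 of the C5–C8 seed-checker typing spec (hsemireg-c5c8-1 g55, 2026-08-31; director-hodge g33 R19.900
# «ONE SHARPENING … one lemma, two customers … c5c8 wires it»): the WIRING LEMMA from a decoration-blind class invariant to v42.4's
# `DecSeparating ∕ OriginDecSeparating` and v42.3's `OriginSeparating`.  ADDITIVE: a NEW file importing v42.4 (`SeedCheckerSplitBlockPicZeroPin`,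
# 65704d1ec475419c, BUILT LD l.24087 18:19:35Z); no declaration of v41 ∕ v42.1–v42.4 is touched or redeclared.  HOME probe of record (same §W over the
# v42.4 body pasted): `hsemireg-c5c8-1/g55/probe/DecSepWiring.lean`.

WHAT IS TYPED ∕ PROVED (sorry-free, standard axioms):
  * `DecBlindInvariant 𝒟 M` — a structure of DATA + HYPOTHESES (nothing asserts one exists): `χ : ∀ A, HasRank A 1 → M` into an additive commutative
    monoid, invariant under isomorphism (`iso`), additive on rank-one tensor products (`tensor`, over the tree's `hasRank_tensorObj_one`), zero on the
    decoration class (`dec`); `DecBlindInvariant.χ_tensor_dec` (a twisted letter has the invariant of the letter);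
  * **`DecSeparating.of_invariant`**: an invariant blind to `𝒟` that SEPARATES THE MODEL'S LETTERS (`χ (ℓ.bundle Z) = χ (ℓ.bundle Z') → Z = Z'`) gives
    `DecSeparating ℓ 𝒟`; `separating_of_invariant` (plain: any iso-invariant separating the letters gives `ℓ.Separating`);
  * **`originDecSeparating_of_invariant`** ∕ **`originSeparating_of_invariant`**: a family of `picZero`-blind invariants, one per CM anchor `(E₀, ψ₀)`
    (`E₀.dim = 1`, `ψ₀² = −1`), separating the ORIGIN letters `(originModel E₀ h1 ψ₀).bundle` gives `OriginDecSeparating`, hence `OriginSeparating`.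

INTENDED INSTANCE (hsemireg-sheaf8-1 g10's chain, `OriginSeparatingReduction.lean` cfa6e22f0b995168 + its successor; NOT constructed here):
`M E₀ := Fin 4 → Fin 3 → ℤ` (factor `f`, test curve `γ ∈ {(o,t), (t,t), (t,ψ₀t)}`), `χ A hA := fun f γ => deg (γ^* σ_f^* (cls hA))`; `iso` = `cls_congr`,
`tensor` = `cls_tensorObj` + pull-back and degree are homomorphisms, `dec` = «a HOMOGENEOUS rank-one module has degree 0 along every test curve»
(Mumford §8 (iv): `Q ∈ Pic⁰ ⇒ (−1)^*Q ≅ Q^∨`, and `deg` is invariant under the automorphism `−1` of `E₀`; or the tree's Pic⁰ ∕ `KTheta = ⊤` dictionary),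
`hsep` = the DEGREE-VALUED Néron–Severi lemma of R19.900 (rows `(1,0,0), (2,−2,N−2), (2,N−2,−2)` with `N = deg (1−ψ₀)^*[o] = 2`, determinant `4 ≠ 0`, per factor).

HONEST REGISTER.  A structure of hypotheses and four implications; no invariant, datum, seed or sheaf is constructed; `OriginDecSeparating` and
`OriginSeparating` remain OPEN (typed, documented true, not proved).  Nothing here proves or refutes `stub_rung2a`, `Rung2a₀ 14`, any row stub, 18881,
18880, 30548, 19780, 27388, № 4, H2, HC_AV, HC_CM or HC; typed ≠ proved; registered ≠ closed.  No `sorry`, no new axiom, no `instance`, no notation.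
-/

set_option linter.dupNamespace false
set_option autoImplicit false

open CategoryTheory AlgebraicGeometry
open Literature.AlgebraicGeometry Literature.AlgebraicGeometry.Motives Literature.AlgebraicGeometry.HodgeTheory
open Literature.AlgebraicTopology.SingularHomology

/-! # §W — THE WIRING LEMMA «one degree lemma, two customers»: a CLASS INVARIANT that is iso-invariant, ADDITIVE on rank-one tensor products and VANISHES on the
decoration class separates cells as soon as it separates the model's letters ⇒ `DecSeparating`; at the law of record a family of such invariants for
`picZero` (sheaf8-1 g10's three test-curve DEGREES of `cls` per factor, which kill `Pic⁰`) gives `OriginDecSeparating` (hence v42.3's `OriginSeparating`). -/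

namespace Summit.HodgeConjecture.HodgeConjecture.Cruxes.BlochSeedDiscOne.SeedChecker

open Summit.HodgeConjecture.HodgeConjecture.Cruxes.BlochSeedDiscOne.Anchor
open Summit.Ventures.HSemireg Summit.Ventures.HSemireg.Pad4Tower
open CategoryTheory.Limits
open Literature.AlgebraicGeometry.Modules

namespace SplitBlock

section Wiring

variable {E₀ : AbelianVariety ℂ}

/-- **a DECORATION-BLIND CLASS INVARIANT** of rank-one modules on the anchor `S⁴`, valued in an additive commutative monoid: invariant under
isomorphism, additive on tensor products of rank-one modules, zero on the decoration class (instance intended: for `picZero`, the vector of DEGREES of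
`detClass` pulled back along finitely many test curves — degrees kill `Pic⁰`).  A structure of data + hypotheses; nothing asserts one exists. -/
structure DecBlindInvariant (𝒟 : DecorationClass E₀) (M : Type*) [AddCommMonoid M] where
  /-- the invariant of a rank-one module -/
  χ : ∀ A : (pad4Anchor E₀).X.left.Modules, HasRank A 1 → M
  /-- invariant under isomorphism -/
  iso : ∀ {A B : (pad4Anchor E₀).X.left.Modules} (_ : A ≅ B) (hA : HasRank A 1) (hB : HasRank B 1), χ A hA = χ B hB
  /-- additive on rank-one tensor products -/
  tensor : ∀ {A B : (pad4Anchor E₀).X.left.Modules} (hA : HasRank A 1) (hB : HasRank B 1),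
    χ (tensorObj A B) (hasRank_tensorObj_one hA hB) = χ A hA + χ B hB
  /-- blind to the decoration class -/
  dec : ∀ (Q : (pad4Anchor E₀).X.left.Modules) (hQ : 𝒟.Dec Q), χ Q (𝒟.hasRank_one Q hQ) = 0

variable {𝒟 : DecorationClass E₀} {M : Type*} [AddCommMonoid M]

/-- the invariant of a twisted letter is the invariant of the letter. -/
theorem DecBlindInvariant.χ_tensor_dec (I : DecBlindInvariant 𝒟 M) {A Q : (pad4Anchor E₀).X.left.Modules} (hA : HasRank A 1) (hQ : 𝒟.Dec Q) :
    I.χ (tensorObj A Q) (hasRank_tensorObj_one hA (𝒟.hasRank_one Q hQ)) = I.χ A hA := by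
  rw [I.tensor hA (𝒟.hasRank_one Q hQ), I.dec Q hQ, add_zero]

/-- **THE WIRING LEMMA**: a decoration-blind invariant that SEPARATES THE MODEL'S LETTERS gives decorated separation. -/
theorem DecSeparating.of_invariant {ℓ : LetterModel E₀} (I : DecBlindInvariant 𝒟 M)
    (hsep : ∀ Z Z' : MCell, I.χ (ℓ.bundle Z) (ℓ.hasRank_one Z) = I.χ (ℓ.bundle Z') (ℓ.hasRank_one Z') → Z = Z') : DecSeparating ℓ 𝒟 :=
  fun Z Z' Q Q' hQ hQ' ⟨e⟩ => hsep Z Z' <| by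
    rw [← I.χ_tensor_dec (ℓ.hasRank_one Z) hQ, ← I.χ_tensor_dec (ℓ.hasRank_one Z') hQ']
    exact I.iso e _ _

/-- (plain separation from ANY iso-invariant that separates the letters — sheaf8-1's `separating_of_letterClass_injective` shape, model-generic.) -/
theorem separating_of_invariant {ℓ : LetterModel E₀} {N : Type*} (χ : ∀ A : (pad4Anchor E₀).X.left.Modules, HasRank A 1 → N)
    (iso : ∀ {A B : (pad4Anchor E₀).X.left.Modules} (_ : A ≅ B) (hA : HasRank A 1) (hB : HasRank B 1), χ A hA = χ B hB)
    (hsep : ∀ Z Z' : MCell, χ (ℓ.bundle Z) (ℓ.hasRank_one Z) = χ (ℓ.bundle Z') (ℓ.hasRank_one Z') → Z = Z') : ℓ.Separating :=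
  fun Z Z' ⟨e⟩ => hsep Z Z' (iso e _ _)

/-- **AT THE LAW OF RECORD**: a `picZero`-blind invariant on every CM anchor separating the ORIGIN letters gives `OriginDecSeparating` … -/
theorem originDecSeparating_of_invariant {M : AbelianVariety ℂ → Type*} [∀ E₀, AddCommMonoid (M E₀)]
    (I : ∀ (E₀ : AbelianVariety ℂ), E₀.dim = 1 → ∀ ψ₀ : E₀ ⟶ E₀, ψ₀ ≫ ψ₀ = -(1 • 𝟙 E₀) → DecBlindInvariant (picZero E₀) (M E₀))
    (hsep : ∀ (E₀ : AbelianVariety ℂ) (h1 : E₀.dim = 1) (ψ₀ : E₀ ⟶ E₀) (hψ : ψ₀ ≫ ψ₀ = -(1 • 𝟙 E₀)) (Z Z' : MCell),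
      (I E₀ h1 ψ₀ hψ).χ ((originModel E₀ h1 ψ₀).bundle Z) ((originModel E₀ h1 ψ₀).hasRank_one Z) =
        (I E₀ h1 ψ₀ hψ).χ ((originModel E₀ h1 ψ₀).bundle Z') ((originModel E₀ h1 ψ₀).hasRank_one Z') → Z = Z') :
    OriginDecSeparating :=
  fun E₀ h1 ψ₀ hψ => DecSeparating.of_invariant (I E₀ h1 ψ₀ hψ) (hsep E₀ h1 ψ₀ hψ)

/-- … and therefore v42.3's `OriginSeparating` as well (one degree lemma, two customers). -/
theorem originSeparating_of_invariant {M : AbelianVariety ℂ → Type*} [∀ E₀, AddCommMonoid (M E₀)]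
    (I : ∀ (E₀ : AbelianVariety ℂ), E₀.dim = 1 → ∀ ψ₀ : E₀ ⟶ E₀, ψ₀ ≫ ψ₀ = -(1 • 𝟙 E₀) → DecBlindInvariant (picZero E₀) (M E₀))
    (hsep : ∀ (E₀ : AbelianVariety ℂ) (h1 : E₀.dim = 1) (ψ₀ : E₀ ⟶ E₀) (hψ : ψ₀ ≫ ψ₀ = -(1 • 𝟙 E₀)) (Z Z' : MCell),
      (I E₀ h1 ψ₀ hψ).χ ((originModel E₀ h1 ψ₀).bundle Z) ((originModel E₀ h1 ψ₀).hasRank_one Z) =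
        (I E₀ h1 ψ₀ hψ).χ ((originModel E₀ h1 ψ₀).bundle Z') ((originModel E₀ h1 ψ₀).hasRank_one Z') → Z = Z') :
    OriginSeparating :=
  (originDecSeparating_of_invariant I hsep).originSeparating

end Wiring

/-! ## Audit (§W): a structure of hypotheses and four implications; no invariant is constructed; `OriginDecSeparating ∕ OriginSeparating` remain OPEN. -/
theorem audit_nothing_decided_wiring : True := trivial

end SplitBlock

end Summit.HodgeConjecture.HodgeConjecture.Cruxes.BlochSeedDiscOne.SeedChecker
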